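import Literature.MathematicalPhysics.QuantumLattice.LayerMarginalsAndPlaneStacks
import HarnessLib

/-!
# Inequivalent-plane (layer-resolved) stacked crystals: two-sided transport of the energy through DENSITY SPLITS,
# plane-by-plane near ground states, word transfer to each plane, exact grand-canonical decoupling and
# doping-split brackets

Topic `Literature/MathematicalPhysics/QuantumLattice` (namespace = path; family `hubbard`; `ℤ^{d+1}` = stacking axis
`0` + `d` in-plane axes). Sequel of `LayerMarginalsAndPlaneStacks` (layer marginals of periodic states, plane
stacks with layer-dependent factors) and of the equal-plane files `LayeredLatticeEnergyTransport` /
`PeriodicLayeredLatticeEnergyTransport`. Written for the multilayer cuprates of the Hubbard material programme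
(stage S2 «families of models» × S3 «interlayer coupling»): in a trilayer crystal the inner plane (no apical
oxygen) and the two outer planes carry DIFFERENT one-band parameters, site energies and hole densities
(Mukuda–Shimizu–Iyo–Kitaoka 2012 §2; one-band parameters per plane from downfolding, Pavarini et al. 2001
eq. (1)), so the crystal cannot be compared with ONE two-dimensional model at ONE filling.

THE MODEL (§1, `planeResolvedViews p ε U u θ w tz`): stacking period `P = p + 1`; the layer class `j` carries
the one-band model `Φ_j = Φ^{0,U_j} + Σ_a θ_{ja} Φ_{u_a}` (`vectorHoppingModel (U j) u (θ j)`: its own repulsion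
and its own hoppings along the common in-plane bond vectors `u_a` — e.g. its own `t, t'`) and the site energy
`ε_j`; interlayer bonds along `w_b` (`(w_b)₀ ≠ 0`) from layers of class `j` carry `tz j b`. All terms are the
sublattice atoms of `SublatticeSelectiveInteractions` on the layer cosets; the views form a linear family over
the null views. THE FUNCTIONAL: the variational cell energy `inf_{S} e(crystal)` over the periodic states
(`periodicStates`) or the periodic states of cell filling `ρ̄` (`periodicStatesAt`) of the stacking superlattice.

THE MATHEMATICS (Rockafellar 1970 Thm. 5.4 / Thm. 16.4: infimal convolution and its conjugate): at `tz = 0`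
the crystal is a union of independent planes, its canonical energy at cell filling `ρ̄` is the INFIMAL
CONVOLUTION `SPLIT(ρ̄) = inf {P⁻¹ Σ_j (e_j(ρ_j) + ε_j ρ_j) : P⁻¹ Σ_j ρ_j = ρ̄}` of the planes' energy
densities `e_j = e_{ρ}(Φ_j)` over DENSITY SPLITS, and its grand potential is the SUM
`P⁻¹ Σ_j p_j(μ − ε_j)` of the planes' grand potentials at SHIFTED chemical potentials; interlayer hopping
moves both by at most the allowance `A = (2/P) Σ_{j,b} |tz j b|`.

## Contents (all PROVED; `e_j(ρ) := (vectorHoppingModel (U j) u (θ j)).tiGroundEnergyDensityAt R ρ`,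
## `g_j(s) := tiGroundEnergyDensity (pencil Φ_j n s) R` = the plane's grand potential at chemical potential `−s`)

* §1 the model `planeResolvedViews`; **the cell energy, plane by plane** (`cellEnergy_planeResolvedViews`, every
  state; `IsPeriodic.cellEnergy_planeResolvedViews`: for a periodic `ω`,
  `e(ω) = P⁻¹ Σ_j [e_{Φ_j}(σ_j) + ε_j ρ(σ_j)] + Σ_{j,b} tz_{jb} K_{jb}(ω)` with `σ_j = ω.layerMarginal (j,0)` the
  TRANSLATION-INVARIANT layer marginals); `abs_sum_interlayer_cellEnergy_le` (`|Σ tz K| ≤ A`).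
* §2 TRANSPORT THROUGH SPLITS: `inv_mul_sum_density_layerMarginal` (mean layer density = cell filling);
  CAP `infCellEnergyOn_planeResolved_le_trial` / **`_le_split`** (`inf_{filling ρ̄} ≤ P⁻¹Σ_j (e_j(ρ_j) + ε_jρ_j)` for
  every realised split of `ρ̄` — plane stack of near-minimisers); FLOOR for every periodic state
  **`IsPeriodic.split_sub_allowance_le_cellEnergy_planeResolved`** (`P⁻¹Σ_j (e_j(ρ_j(ω)) + ε_jρ_j(ω)) − A ≤ e(ω)` at the
  state's OWN split); **`le_infCellEnergyOn_planeResolved_of_forall_split`** (a bound below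
  `P⁻¹Σ(e_j(ρ_j)+ε_jρ_j)` for all realised splits of `ρ̄` is, minus `A`, a floor);
  **`le_infCellEnergyOn_planeResolved_of_gcFloors`** (THE CONSUMER'S FLOOR DEVICE: grand-potential floors
  `c_j ≤ g_j(ε_j − μ)` of the planes at ONE common `μ` give `P⁻¹Σ_j c_j + μρ̄ − A ≤ inf_{filling ρ̄} e`);
  `periodicStatesAt_stackPeriods_nonempty`.
* §3 PLANE BY PLANE (ε-FREE): **`IsPeriodic.sum_layerExcess_le`** — for a periodic `ω` within `δ` of the infimum
  at its own cell filling, `Σ_j [e_{Φ_j}(σ_j) − e_j(ρ(σ_j))] ≤ Pδ + 2Σ|tz|` with every summand `≥ 0`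
  (`tiGroundEnergyDensityAt_le_meanEnergy_layerMarginal`), hence **`IsPeriodic.meanEnergy_layerMarginal_le`**:
  EVERY PLANE MARGINAL IS A NEAR GROUND STATE OF ITS OWN PLANE MODEL AT ITS OWN FILLING, whatever the site
  energies; **`IsPeriodic.of_energyWindow_word_layerMarginal`**: a 2D energy-window word for the plane model `Φ_j`
  issued on a FILLING RANGE with slack `ε' ≥ Pδ + 2Σ|tz|` holds for the marginal of plane `j` (inner and outer
  planes get their OWN words).
* §4 GRAND-CANONICAL FORM (site energies `ε_j − μ`): `IsPeriodic.cellEnergy_planeResolvedViews_sub_mu`;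
  **`infCellEnergyOn_planeResolved_gc_mem_Icc`**: `inf_{periodic} e_μ ∈ [P⁻¹Σ_j g_j(ε_j−μ) − A, P⁻¹Σ_j g_j(ε_j−μ)]`
  (EXACT decoupling of the plane grand potentials at shifted chemical potentials, up to `A`;
  `_gc_le_trial/_gc_le`, `IsPeriodic.gc_sub_allowance_le_cellEnergy_planeResolved`,
  `gc_sub_allowance_le_infCellEnergyOn_planeResolved`); GC ENERGY BUDGETS: `IsPeriodic.sum_layerExcess_gc_le_of_budget`,
  `IsPeriodic.meanEnergy_layerMarginal_gc_le_of_budget`, **`IsPeriodic.layerDensity_brackets_of_budget`** (Griffiths: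
  `(g_j(s_j+h) − g_j(s_j) − Δ)/h ≤ ρ_j ≤ (g_j(s_j) − g_j(s_j−h) + Δ)/h`, `s_j = ε_j − μ`, `Δ = Pδ' + 2Σ|tz|`); the
  budget of a GC near minimiser (`gc_budget_of_gc_nearMin`: `δ' = δ`) and of a CANONICAL near minimiser at any
  trial `μ` (`gc_budget_of_nearMin`: `δ' = δ + B(μ)`, `B(μ) = inf_{ρ̄} e − μρ̄ − P⁻¹Σ g_j ≥ −A`,
  `gc_sub_allowance_le_infCellEnergyOn_planeResolved_sub_mu`); the DOPING-SPLIT BRACKETS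
  **`IsPeriodic.layerDensity_brackets`** (GC) and **`IsPeriodic.layerDensity_brackets_canonical`** — the layer-resolved
  densities (inner vs outer plane doping) of every periodic near ground state of the crystal from certified
  two-sided bounds on the PLANES' 2D grand potentials at three chemical potentials each.

No named fact, no number of record, no `sorry`; definition with body: `planeResolvedViews` (and the auxiliary
`layerHom_apply_zero`). HONEST SCOPE: energies and conjugate densities only (no order parameter — order WORDS are
transferred by §3 as hypotheses `P σ`, not produced); `T = 0`; the identification of the cell energy with the
thermodynamic limit of `ω(H_Λ)/|Λ|` for periodic states is the periodic twin of Bratteli–Robinson II §6.2.4 and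
is not restated; the allowance is the norm row `2|t|` per interlayer bond (the kinematic `4/π` single-direction
row is not in the tree); plane-dependent INTERLAYER vectors (e.g. different apical environments) are covered by the
class-dependent amplitudes `tz j b` over a common vector list.

## Tree / Mathlib search

REUSED from `LayerMarginalsAndPlaneStacks`: `layerCell`, `cellPos_layerCell`, `sum_cell_eq_sum_layerCell`,
`nullInteraction`, `cellEnergy_nullViews`, `cellEnergy_sublatticeOnSiteViews_layerCoset`,
`cellEnergy_sublatticeVectorHoppingViews_layerCoset_inPlane`, `abs_cellEnergy_sublatticeVectorHoppingViews_layerCoset_le`,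
`layerMarginal`, `density_layerMarginal`, `IsPeriodic.isTranslationInvariant_layerMarginal`,
`IsPeriodic.meanEnergy_vectorHoppingModel_layerMarginal`, `planeStack`, `isPeriodic_planeStack`,
`layerMarginal_planeStack_layerCoset`, `cellEnergy_planeStack_sublatticeVectorHoppingViews_eq_zero`,
`planeStack_mem_periodicStatesAt`; `viewFamily`, `cellEnergy_viewFamily`, `infCellEnergyOn(_le_cellEnergy)`, `le_infCellEnergyOn`,
`periodicStates(At)`, `cellFilling_eq_density_cellAverage`, `density_shiftAverage` (`SuperlatticeCellEnergyFamilies` /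
`PeriodicStatesCellAverage`); `vectorHoppingModel`, `layerHom(_ne_zero/_mem_thicken)` (`LayeredLatticeEnergyTransport`);
`tiGroundEnergyDensityAt(_le_meanEnergy)`, `le_tiGroundEnergyDensityAt`, `exists_meanEnergy_lt_of_infMeanEnergyOn_lt`
(`TIGroundEnergyDensityCouplingFamilies`); `pencil`, `meanEnergy_pencil(_eq_add_sub_mul)`, `numberInteraction`,
`meanEnergy_numberInteraction`, `tiGroundEnergyDensity(_le_meanEnergy)`, `le_tiGroundEnergyDensity`,
`exists_meanEnergy_lt_of_tiGroundEnergyDensity_lt` (`TIGroundEnergyDensityResponse`); `IsTranslationInvariant.isEven`;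
`vacuumState_isTranslationInvariant`. `lean search 'inequivalent|planeResolved|layerDensity|inner plane' --decl`: only
`HalfBathtubPairTableRowsHg1223*` (certified 2D rows PER PLANE of Hg-1223 — consumers of §3) and `BilayerSplittingIdentities`
(one-body).

## References

* R. T. Rockafellar, *Convex Analysis* (1970), Thm. 5.4 (infimal convolution of convex functions), Thm. 16.4
  (conjugate of an infimal convolution = sum of conjugates). [cite: Rockafellar1970, Thm 16.4]
* H. Araki, H. Moriya, Rev. Math. Phys. 15 (2003) 93, §11.1 Theorem 11.2 (product states), §4.1. [cite: ArakiMoriya2003, §11.1 Theorem 11.2]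
* O. Bratteli, A. Kishimoto, D. W. Robinson, CMP 64 (1978) 41, Thm. 2 (variational principle). [cite: BratteliKishimotoRobinson1978, Thm. 2 (condition 2)]
* O. Bratteli, D. W. Robinson, *OAQSM 1* (1987), Prop. 2.3.11, §4.3.1. [cite: BratteliRobinsonI1987, Prop. 2.3.11]
* D. Ruelle, *Statistical Mechanics: Rigorous Results* (1969), §3.4 (convexity in the density, chemical potential).
  [cite: Ruelle1969, §3.4]
* R. B. Griffiths, J. Math. Phys. 5 (1964) 1215 / Koma–Tasaki (1994) §1 (tangent brackets on conjugate densities).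
  [cite: KomaTasaki1994, §1]
* H. Mukuda, S. Shimizu, A. Iyo, Y. Kitaoka, J. Phys. Soc. Jpn. 81 (2012) 011008, §2 (inequivalent inner / outer planes
  of multilayered cuprates; layer-resolved doping). [cite: MukudaEtAl2012, §2]
* E. Pavarini et al., PRL 87 (2001) 047003, eq. (1). [cite: PavariniEtAl2001, eq. (1)]
-/

noncomputable section

namespace Literature.MathematicalPhysics.QuantumLattice

open Matrix Finset HubbardWave0 Literature.Probability.LatticeModels ThermodynamicLimit
open scoped ComplexOrder BigOperators

variable {d : ℕ}

/-! ### §1. The plane-resolved (inequivalent-layer) crystal and its cell energy -/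

section Model

variable {ι κ : Type*} [Fintype ι] [Fintype κ]

/-- Lifted in-plane vectors have layer coordinate `0`. [cite: ArakiMoriya2003, §4.1] -/
theorem layerHom_apply_zero (u : Site d) : layerHom d u 0 = 0 := by
  rw [layerHom_apply, Fin.cons_zero]

variable (p : ℕ)

/-- **The plane-resolved stacked crystal** (stacking period `p + 1`): the layer class `j` carries the one-band
model with repulsion `U j`, hoppings `θ j a` along the lifted in-plane vectors `(0, u a)` and site energy `ε j`;
interlayer bonds along `w b` starting in a layer of class `j` carry `tz j b`. A linear family of views over the
null views whose directions are the sublattice atoms of the layer cosets (on-site `(1,0)` and `(0,1)` atoms,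
in-plane and interlayer hopping patterns). The one-band Hamiltonian of a multilayer crystal with INEQUIVALENT
planes (inner / outer planes of a trilayer cuprate). [cite: MukudaEtAl2012, §2] -/
def planeResolvedViews (ε U : Fin (p + 1) → ℝ) (u : ι → Site d) (θ : Fin (p + 1) → ι → ℝ) (w : κ → Site (d + 1))
    (tz : Fin (p + 1) → κ → ℝ) : Cell (stackPeriods d p) → FermionInteraction (d + 1) :=
  viewFamily
    (viewFamily
      (viewFamily
        (viewFamily (fun _ => nullInteraction (d + 1))
          (fun j : Fin (p + 1) => sublatticeOnSiteViews (stackPeriods d p) (layerCoset d j) 1 0) ε)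
        (fun j : Fin (p + 1) => sublatticeOnSiteViews (stackPeriods d p) (layerCoset d j) 0 1) U)
      (fun ja : Fin (p + 1) × ι =>
        sublatticeVectorHoppingViews (stackPeriods d p) (layerCoset d ja.1) (layerHom d (u ja.2)) 1)
      fun ja => θ ja.1 ja.2)
    (fun jb : Fin (p + 1) × κ => sublatticeVectorHoppingViews (stackPeriods d p) (layerCoset d jb.1) (w jb.2) 1)
    fun jb => tz jb.1 jb.2

/-- **The cell energy of the plane-resolved crystal, layer by layer** (every state `ω` of `ℤ^{d+1}`):
`e(ω) = (p+1)⁻¹ Σ_j [ε_j ρ_j + U_j D_j + Σ_a θ_{ja} K_{(0,u_a)}(ω ∘ τ_{(j,0)})] + Σ_{j,b} tz_{jb} e_{jb}(ω)` with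
`ρ_j, D_j` the density / double occupancy of `ω ∘ τ_{(j,0)}` and `e_{jb}` the cell energies of the interlayer
patterns. [cite: BratteliKishimotoRobinson1978, §3 (mean energy functional)] -/
theorem InfVolFermionState.cellEnergy_planeResolvedViews (ω : InfVolFermionState (d + 1)) (ε U : Fin (p + 1) → ℝ)
    {u : ι → Site d} (hu : ∀ a, u a ≠ 0) (θ : Fin (p + 1) → ι → ℝ) (w : κ → Site (d + 1))
    (tz : Fin (p + 1) → κ → ℝ) {R : ℝ} (huR : ∀ a, layerHom d (u a) ∈ thicken ({0} : Finset (Site (d + 1))) R) :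
    ω.cellEnergy (planeResolvedViews p ε U u θ w tz) R =
      ((p : ℝ) + 1)⁻¹ * ∑ j : Fin (p + 1),
        (ε j * (ω.shift (layerCoset d j)).density +
          U j * ((ω.shift (layerCoset d j)).expect {0}
            (nAt (0 : Site (d + 1)) (mem_singleton_self 0) 0 * nAt 0 (mem_singleton_self 0) 1)).re +
          ∑ a, θ j a * (ω.shift (layerCoset d j)).meanEnergy
            (vectorHoppingFermionInteraction (d + 1) (layerHom d (u a)) 1) R) +
      ∑ jb : Fin (p + 1) × κ, tz jb.1 jb.2 *
        ω.cellEnergy (sublatticeVectorHoppingViews (stackPeriods d p) (layerCoset d jb.1) (w jb.2) 1) R := by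
  have hK : ∀ (j : Fin (p + 1)) (a : ι),
      ω.cellEnergy (sublatticeVectorHoppingViews (stackPeriods d p) (layerCoset d j) (layerHom d (u a)) 1) R =
        ((p : ℝ) + 1)⁻¹ * (ω.shift (layerCoset d j)).meanEnergy
          (vectorHoppingFermionInteraction (d + 1) (layerHom d (u a)) 1) R := fun j a =>
    ω.cellEnergy_sublatticeVectorHoppingViews_layerCoset_inPlane p j (layerHom_ne_zero (hu a))
      (layerHom_apply_zero (u a)) 1 (huR a)
  rw [planeResolvedViews, InfVolFermionState.cellEnergy_viewFamily, InfVolFermionState.cellEnergy_viewFamily,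
    InfVolFermionState.cellEnergy_viewFamily, InfVolFermionState.cellEnergy_viewFamily,
    InfVolFermionState.cellEnergy_nullViews, zero_add, Fintype.sum_prod_type]
  simp only [InfVolFermionState.cellEnergy_sublatticeOnSiteViews_layerCoset, hK, one_mul, zero_mul, add_zero, zero_add]
  congr 1
  rw [← Finset.sum_add_distrib, ← Finset.sum_add_distrib, Finset.mul_sum]
  refine Finset.sum_congr rfl fun j _ => ?_
  rw [mul_add, mul_add, Finset.mul_sum]
  have h3 : ∑ a, θ j a * (((p : ℝ) + 1)⁻¹ *
      (ω.shift (layerCoset d j)).meanEnergy (vectorHoppingFermionInteraction (d + 1) (layerHom d (u a)) 1) R) =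
      ∑ a, ((p : ℝ) + 1)⁻¹ * (θ j a *
        (ω.shift (layerCoset d j)).meanEnergy (vectorHoppingFermionInteraction (d + 1) (layerHom d (u a)) 1) R) :=
    Finset.sum_congr rfl fun a _ => by ring
  rw [h3]
  ring

/-- **The cell energy of a PERIODIC state, plane by plane**:
`e(ω) = (p+1)⁻¹ Σ_j [e_{Φ_j}(σ_j) + ε_j ρ(σ_j)] + Σ_{j,b} tz_{jb} e_{jb}(ω)`, `σ_j = ω.layerMarginal (j,0)` the
(translation-invariant) marginal of the layer of class `j` and `Φ_j = vectorHoppingModel (U j) u (θ j)` ITS OWN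
plane model. [cite: BratteliKishimotoRobinson1978, §3 (mean energy functional)] -/
theorem InfVolFermionState.IsPeriodic.cellEnergy_planeResolvedViews {ω : InfVolFermionState (d + 1)}
    (hω : ω.IsPeriodic (stackPeriods d p)) (ε U : Fin (p + 1) → ℝ) {u : ι → Site d} (hu : ∀ a, u a ≠ 0)
    (θ : Fin (p + 1) → ι → ℝ) (w : κ → Site (d + 1)) (tz : Fin (p + 1) → κ → ℝ) {R R' : ℝ} (hR : 1 ≤ R)
    (hRR' : R ≤ R') (huR : ∀ a, u a ∈ thicken ({0} : Finset (Site d)) R) :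
    ω.cellEnergy (planeResolvedViews p ε U u θ w tz) R' =
      ((p : ℝ) + 1)⁻¹ * ∑ j : Fin (p + 1),
        ((ω.layerMarginal (layerCoset d j)).meanEnergy (vectorHoppingModel (U j) u (θ j)) R +
          ε j * (ω.layerMarginal (layerCoset d j)).density) +
      ∑ jb : Fin (p + 1) × κ, tz jb.1 jb.2 *
        ω.cellEnergy (sublatticeVectorHoppingViews (stackPeriods d p) (layerCoset d jb.1) (w jb.2) 1) R' := by
  rw [ω.cellEnergy_planeResolvedViews p ε U hu θ w tz
    (fun a => thicken_mono _ hRR' (layerHom_mem_thicken (huR a)))]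
  congr 1
  refine congrArg _ (Finset.sum_congr rfl fun j _ => ?_)
  rw [hω.meanEnergy_vectorHoppingModel_layerMarginal (layerCoset d j) (U j) hu (θ j) hR hRR' huR,
    InfVolFermionState.density_layerMarginal]
  ring

/-- **The interlayer remainder is bounded by the allowance** `A = (2/(p+1)) Σ_{j,b} |tz j b|` (sharp class
constant `2|t|/|cell|` per pattern). [cite: BratteliRobinsonI1987, Prop. 2.3.11] -/
theorem InfVolFermionState.abs_sum_interlayer_cellEnergy_le (ω : InfVolFermionState (d + 1)) {w : κ → Site (d + 1)}
    (hw : ∀ b, w b ≠ 0) (tz : Fin (p + 1) → κ → ℝ) {R' : ℝ}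
    (hwR' : ∀ b, w b ∈ thicken ({0} : Finset (Site (d + 1))) R') :
    |∑ jb : Fin (p + 1) × κ, tz jb.1 jb.2 *
        ω.cellEnergy (sublatticeVectorHoppingViews (stackPeriods d p) (layerCoset d jb.1) (w jb.2) 1) R'| ≤
      2 / ((p : ℝ) + 1) * ∑ jb : Fin (p + 1) × κ, |tz jb.1 jb.2| := by
  rw [Finset.mul_sum]
  refine (Finset.abs_sum_le_sum_abs _ _).trans (Finset.sum_le_sum fun jb _ => ?_)
  have h := ω.abs_cellEnergy_sublatticeVectorHoppingViews_layerCoset_le p jb.1 (hw jb.2) 1 (hwR' jb.2)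
  rw [abs_one, mul_one] at h
  rw [abs_mul, mul_comm (2 / ((p : ℝ) + 1)) |tz jb.1 jb.2|]
  exact mul_le_mul_of_nonneg_left h (abs_nonneg _)

end Model

/-! ### §2. Two-sided transport through density splits -/

section Transport

variable {ι κ : Type*} [Fintype ι] [Fintype κ] (p : ℕ)

/-- **The mean of the layer densities is the cell filling**: `(p+1)⁻¹ Σ_j ρ(σ_j) = ρ̄(ω)` — the layer densities
of a state ARE a density split of its cell filling. [cite: ArakiMoriya2003, §4.1] -/
theorem InfVolFermionState.inv_mul_sum_density_layerMarginal (ω : InfVolFermionState (d + 1)) :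
    ((p : ℝ) + 1)⁻¹ * ∑ j : Fin (p + 1), (ω.layerMarginal (layerCoset d j)).density = ω.cellFilling (stackPeriods d p) := by
  rw [InfVolFermionState.cellFilling_eq_density_cellAverage, InfVolFermionState.cellAverage, density_shiftAverage,
    card_cell_stackPeriods, Nat.cast_add, Nat.cast_one, sum_cell_eq_sum_layerCell]
  simp only [cellPos_layerCell, InfVolFermionState.density_layerMarginal]

/-- **CAP, trial form**: for translation-invariant states `σ_j` of `ℤ^d` (`0 < d`), the infimum over the periodic
states of cell filling `(p+1)⁻¹Σ_j ρ(σ_j)` is at most `(p+1)⁻¹ Σ_j [e_{Φ_j}(σ_j) + ε_j ρ(σ_j)]` (the plane stack of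
the `σ_j` is a periodic trial state that sees no interlayer bond). [cite: ArakiMoriya2003, §11.1 Theorem 11.2] -/
theorem infCellEnergyOn_planeResolved_le_trial (hd : 0 < d) (ε U : Fin (p + 1) → ℝ) {u : ι → Site d}
    (hu : ∀ a, u a ≠ 0) (θ : Fin (p + 1) → ι → ℝ) {w : κ → Site (d + 1)} (hw : ∀ b, w b 0 ≠ 0)
    (tz : Fin (p + 1) → κ → ℝ) {R R' : ℝ} (hR : 1 ≤ R) (hRR' : R ≤ R')
    (huR : ∀ a, u a ∈ thicken ({0} : Finset (Site d)) R) (hwR' : ∀ b, w b ∈ thicken ({0} : Finset (Site (d + 1))) R')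
    {σ : Fin (p + 1) → InfVolFermionState d} (hσ : ∀ j, (σ j).IsTranslationInvariant) :
    infCellEnergyOn (periodicStatesAt (stackPeriods d p) (((p : ℝ) + 1)⁻¹ * ∑ j, (σ j).density))
        (planeResolvedViews p ε U u θ w tz) R' ≤
      ((p : ℝ) + 1)⁻¹ * ∑ j, ((σ j).meanEnergy (vectorHoppingModel (U j) u (θ j)) R + ε j * (σ j).density) := by
  have he : ∀ j, (σ j).IsEven := fun j => (hσ j).isEven hd
  have hmem := InfVolFermionState.planeStack_mem_periodicStatesAt (p := p) hσ he
  refine (infCellEnergyOn_le_cellEnergy _ R' hmem).trans (le_of_eq ?_)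
  rw [(InfVolFermionState.isPeriodic_planeStack hσ he).cellEnergy_planeResolvedViews p ε U hu θ w tz hR hRR' huR]
  simp only [InfVolFermionState.layerMarginal_planeStack_layerCoset,
    InfVolFermionState.cellEnergy_planeStack_sublatticeVectorHoppingViews_eq_zero _ _ _ _ (hw _) 1 (hwR' _), mul_zero,
    Finset.sum_const_zero, add_zero]

/-- **CAP through a density split** (infimal-convolution upper bound): for every REALISED split `(ρ_j)`,
`inf_{periodic, filling (p+1)⁻¹Σρ_j} e ≤ (p+1)⁻¹ Σ_j [e_j(ρ_j) + ε_j ρ_j]`, `e_j(ρ) = e_ρ(Φ_j)` the plane's own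
fixed-filling variational density. [cite: Rockafellar1970, Thm 5.4] -/
theorem infCellEnergyOn_planeResolved_le_split (hd : 0 < d) (ε U : Fin (p + 1) → ℝ) {u : ι → Site d}
    (hu : ∀ a, u a ≠ 0) (θ : Fin (p + 1) → ι → ℝ) {w : κ → Site (d + 1)} (hw : ∀ b, w b 0 ≠ 0)
    (tz : Fin (p + 1) → κ → ℝ) {R R' : ℝ} (hR : 1 ≤ R) (hRR' : R ≤ R')
    (huR : ∀ a, u a ∈ thicken ({0} : Finset (Site d)) R) (hwR' : ∀ b, w b ∈ thicken ({0} : Finset (Site (d + 1))) R')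
    (ρ : Fin (p + 1) → ℝ) (hne : ∀ j, ∃ ω₀ : InfVolFermionState d, ω₀.IsTranslationInvariant ∧ ω₀.density = ρ j) :
    infCellEnergyOn (periodicStatesAt (stackPeriods d p) (((p : ℝ) + 1)⁻¹ * ∑ j, ρ j))
        (planeResolvedViews p ε U u θ w tz) R' ≤
      ((p : ℝ) + 1)⁻¹ * ∑ j, ((vectorHoppingModel (U j) u (θ j)).tiGroundEnergyDensityAt R (ρ j) + ε j * ρ j) := by
  have hP : (0 : ℝ) < (p : ℝ) + 1 := by positivity
  refine le_of_forall_pos_le_add fun δ hδ => ?_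
  have hex : ∀ j, ∃ σ : InfVolFermionState d, (σ.IsTranslationInvariant ∧ σ.density = ρ j) ∧
      σ.meanEnergy (vectorHoppingModel (U j) u (θ j)) R <
        (vectorHoppingModel (U j) u (θ j)).tiGroundEnergyDensityAt R (ρ j) + δ := fun j => by
    obtain ⟨σ, hσ, hlt⟩ := FermionInteraction.exists_meanEnergy_lt_of_infMeanEnergyOn_lt
      (vectorHoppingModel (U j) u (θ j)) R
      (S := {ω : InfVolFermionState d | ω.IsTranslationInvariant ∧ ω.density = ρ j}) (hne j)
      (lt_add_of_pos_right _ hδ)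
    exact ⟨σ, hσ, hlt⟩
  choose σ hσ hlt using hex
  have h := infCellEnergyOn_planeResolved_le_trial p hd ε U hu θ hw tz hR hRR' huR hwR' (fun j => (hσ j).1)
  simp only [(hσ _).2] at h
  refine h.trans ?_
  calc ((p : ℝ) + 1)⁻¹ * ∑ j, ((σ j).meanEnergy (vectorHoppingModel (U j) u (θ j)) R + ε j * ρ j)
      ≤ ((p : ℝ) + 1)⁻¹ * ∑ j, (((vectorHoppingModel (U j) u (θ j)).tiGroundEnergyDensityAt R (ρ j) + ε j * ρ j) + δ) :=
        mul_le_mul_of_nonneg_left (Finset.sum_le_sum fun j _ => by linarith [hlt j]) (inv_pos.2 hP).le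
    _ = _ := by
        rw [Finset.sum_add_distrib, Finset.sum_const, Finset.card_univ, Fintype.card_fin, nsmul_eq_mul, mul_add,
          Nat.cast_add, Nat.cast_one, inv_mul_cancel_left₀ hP.ne']

/-- **FLOOR for every periodic state, at its OWN split**:
`(p+1)⁻¹ Σ_j [e_j(ρ(σ_j)) + ε_j ρ(σ_j)] − A ≤ e(ω)` — each layer marginal is a translation-invariant state of `ℤ^d`
of its own density, and the interlayer bonds cost at most the allowance. [cite: BratteliKishimotoRobinson1978, Thm. 2 (condition 2)] -/
theorem InfVolFermionState.IsPeriodic.split_sub_allowance_le_cellEnergy_planeResolved {ω : InfVolFermionState (d + 1)}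
    (hω : ω.IsPeriodic (stackPeriods d p)) (ε U : Fin (p + 1) → ℝ) {u : ι → Site d} (hu : ∀ a, u a ≠ 0)
    (θ : Fin (p + 1) → ι → ℝ) {w : κ → Site (d + 1)} (hw : ∀ b, w b ≠ 0) (tz : Fin (p + 1) → κ → ℝ) {R R' : ℝ}
    (hR : 1 ≤ R) (hRR' : R ≤ R') (huR : ∀ a, u a ∈ thicken ({0} : Finset (Site d)) R)
    (hwR' : ∀ b, w b ∈ thicken ({0} : Finset (Site (d + 1))) R') :
    ((p : ℝ) + 1)⁻¹ * ∑ j : Fin (p + 1),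
        ((vectorHoppingModel (U j) u (θ j)).tiGroundEnergyDensityAt R ((ω.layerMarginal (layerCoset d j)).density) +
          ε j * (ω.layerMarginal (layerCoset d j)).density) -
        2 / ((p : ℝ) + 1) * ∑ jb : Fin (p + 1) × κ, |tz jb.1 jb.2| ≤
      ω.cellEnergy (planeResolvedViews p ε U u θ w tz) R' := by
  have hP : (0 : ℝ) < (p : ℝ) + 1 := by positivity
  rw [hω.cellEnergy_planeResolvedViews p ε U hu θ w tz hR hRR' huR]
  have hI := (abs_le.1 (ω.abs_sum_interlayer_cellEnergy_le p hw tz hwR')).1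
  have h1 : ∑ j : Fin (p + 1),
      ((vectorHoppingModel (U j) u (θ j)).tiGroundEnergyDensityAt R ((ω.layerMarginal (layerCoset d j)).density) +
        ε j * (ω.layerMarginal (layerCoset d j)).density) ≤
      ∑ j : Fin (p + 1), ((ω.layerMarginal (layerCoset d j)).meanEnergy (vectorHoppingModel (U j) u (θ j)) R +
        ε j * (ω.layerMarginal (layerCoset d j)).density) :=
    Finset.sum_le_sum fun j _ => by
      linarith [(vectorHoppingModel (U j) u (θ j)).tiGroundEnergyDensityAt_le_meanEnergy R
        (hω.isTranslationInvariant_layerMarginal (layerCoset d j)) rfl]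
  have h2 := mul_le_mul_of_nonneg_left h1 (inv_pos.2 hP).le
  linarith

/-- **FLOOR through density splits** (infimal-convolution lower bound): a number `m` below
`(p+1)⁻¹ Σ_j [e_j(ρ_j) + ε_j ρ_j]` for EVERY realised split of `ρ̄` satisfies `m − A ≤ inf_{periodic, filling ρ̄} e`.
[cite: Rockafellar1970, Thm 5.4] -/
theorem le_infCellEnergyOn_planeResolved_of_forall_split (ε U : Fin (p + 1) → ℝ) {u : ι → Site d}
    (hu : ∀ a, u a ≠ 0) (θ : Fin (p + 1) → ι → ℝ) {w : κ → Site (d + 1)} (hw : ∀ b, w b ≠ 0)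
    (tz : Fin (p + 1) → κ → ℝ) {R R' : ℝ} (hR : 1 ≤ R) (hRR' : R ≤ R')
    (huR : ∀ a, u a ∈ thicken ({0} : Finset (Site d)) R) (hwR' : ∀ b, w b ∈ thicken ({0} : Finset (Site (d + 1))) R')
    {ρbar m : ℝ} (hS : (periodicStatesAt (stackPeriods d p) ρbar).Nonempty)
    (hm : ∀ ρ : Fin (p + 1) → ℝ, (∀ j, ∃ ω₀ : InfVolFermionState d, ω₀.IsTranslationInvariant ∧ ω₀.density = ρ j) →
      ((p : ℝ) + 1)⁻¹ * ∑ j, ρ j = ρbar →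
        m ≤ ((p : ℝ) + 1)⁻¹ * ∑ j, ((vectorHoppingModel (U j) u (θ j)).tiGroundEnergyDensityAt R (ρ j) + ε j * ρ j)) :
    m - 2 / ((p : ℝ) + 1) * ∑ jb : Fin (p + 1) × κ, |tz jb.1 jb.2| ≤
      infCellEnergyOn (periodicStatesAt (stackPeriods d p) ρbar) (planeResolvedViews p ε U u θ w tz) R' := by
  refine le_infCellEnergyOn _ R' hS fun ω hω => ?_
  have hsplit := hm (fun j => (ω.layerMarginal (layerCoset d j)).density)
    (fun j => ⟨_, hω.1.isTranslationInvariant_layerMarginal _, rfl⟩)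
    (by rw [ω.inv_mul_sum_density_layerMarginal p, hω.2])
  have hfloor := hω.1.split_sub_allowance_le_cellEnergy_planeResolved p ε U hu θ hw tz hR hRR' huR hwR'
  linarith

/-- **THE FLOOR DEVICE: one common chemical potential, the planes' own grand-potential floors.** If
`c_j ≤ g_j(ε_j − μ)` (a certified floor under plane `j`'s 2D grand potential at the SHIFTED chemical potential
`μ − ε_j`; `g_j(s) = inf_{TI σ} [e_{Φ_j}(σ) + s ρ(σ)]`), then `(p+1)⁻¹ Σ_j c_j + μ ρ̄ − A ≤ inf_{periodic, filling ρ̄} e`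
— the conjugate of the infimal convolution is the sum of the conjugates. [cite: Rockafellar1970, Thm 16.4] -/
theorem le_infCellEnergyOn_planeResolved_of_gcFloors (ε U : Fin (p + 1) → ℝ) {u : ι → Site d}
    (hu : ∀ a, u a ≠ 0) (θ : Fin (p + 1) → ι → ℝ) {w : κ → Site (d + 1)} (hw : ∀ b, w b ≠ 0)
    (tz : Fin (p + 1) → κ → ℝ) {R R' : ℝ} (hR : 1 ≤ R) (hRR' : R ≤ R')
    (huR : ∀ a, u a ∈ thicken ({0} : Finset (Site d)) R) (hwR' : ∀ b, w b ∈ thicken ({0} : Finset (Site (d + 1))) R')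
    {ρbar : ℝ} (hS : (periodicStatesAt (stackPeriods d p) ρbar).Nonempty) (μ : ℝ) (c : Fin (p + 1) → ℝ)
    (hc : ∀ j, c j ≤ (FermionInteraction.pencil (vectorHoppingModel (U j) u (θ j)) (numberInteraction d)
      (ε j - μ)).tiGroundEnergyDensity R) :
    ((p : ℝ) + 1)⁻¹ * ∑ j, c j + μ * ρbar - 2 / ((p : ℝ) + 1) * ∑ jb : Fin (p + 1) × κ, |tz jb.1 jb.2| ≤
      infCellEnergyOn (periodicStatesAt (stackPeriods d p) ρbar) (planeResolvedViews p ε U u θ w tz) R' := by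
  have hP : (0 : ℝ) < (p : ℝ) + 1 := by positivity
  refine le_infCellEnergyOn_planeResolved_of_forall_split p ε U hu θ hw tz hR hRR' huR hwR' hS fun ρ hne hmean => ?_
  have hterm : ∀ j, c j + μ * ρ j ≤ (vectorHoppingModel (U j) u (θ j)).tiGroundEnergyDensityAt R (ρ j) + ε j * ρ j := by
    intro j
    have h := (vectorHoppingModel (U j) u (θ j)).le_tiGroundEnergyDensityAt R (hne j) (c := c j + μ * ρ j - ε j * ρ j)
      fun σ hσ hρσ => by
        have h1 := (hc j).trans
          ((FermionInteraction.pencil (vectorHoppingModel (U j) u (θ j)) (numberInteraction d)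
            (ε j - μ)).tiGroundEnergyDensity_le_meanEnergy R hσ)
        rw [InfVolFermionState.meanEnergy_pencil, InfVolFermionState.meanEnergy_numberInteraction, hρσ] at h1
        linarith
    linarith
  have hsum : ((p : ℝ) + 1)⁻¹ * ∑ j, c j + μ * ρbar = ((p : ℝ) + 1)⁻¹ * ∑ j, (c j + μ * ρ j) := by
    rw [← hmean, Finset.sum_add_distrib, mul_add, ← Finset.mul_sum]
    ring
  rw [hsum]
  exact mul_le_mul_of_nonneg_left (Finset.sum_le_sum fun j _ => hterm j) (inv_pos.2 hP).le

/-- Realised splits give non-empty filling classes (the plane stack). [cite: ArakiMoriya2003, §11.1 Theorem 11.2] -/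
theorem periodicStatesAt_stackPeriods_nonempty (hd : 0 < d) {σ : Fin (p + 1) → InfVolFermionState d}
    (hσ : ∀ j, (σ j).IsTranslationInvariant) :
    (periodicStatesAt (stackPeriods d p) (((p : ℝ) + 1)⁻¹ * ∑ j, (σ j).density)).Nonempty :=
  ⟨_, InfVolFermionState.planeStack_mem_periodicStatesAt (p := p) hσ fun j => (hσ j).isEven hd⟩

end Transport

/-! ### §3. Every periodic ground state is, plane by plane, a near ground state of its own plane -/

section NearGroundStates

variable {ι κ : Type*} [Fintype ι] [Fintype κ] (p : ℕ)

/-- **PLANE-BY-PLANE EXCESS BOUND (site-energy free).** For a periodic `ω` within `δ` of the infimum at its own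
cell filling, `Σ_j [e_{Φ_j}(σ_j) − e_j(ρ(σ_j))] ≤ (p+1)δ + 2Σ_{j,b}|tz j b|`: cap at the state's OWN split (realised
by its own marginals) against the plane-by-plane energy formula — the site energies `ε_j` CANCEL.
[cite: BratteliKishimotoRobinson1978, Thm. 2 (condition 2)] -/
theorem InfVolFermionState.IsPeriodic.sum_layerExcess_le {ω : InfVolFermionState (d + 1)}
    (hω : ω.IsPeriodic (stackPeriods d p)) (hd : 0 < d) (ε U : Fin (p + 1) → ℝ) {u : ι → Site d}
    (hu : ∀ a, u a ≠ 0) (θ : Fin (p + 1) → ι → ℝ) {w : κ → Site (d + 1)} (hw : ∀ b, w b 0 ≠ 0)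
    (tz : Fin (p + 1) → κ → ℝ) {R R' : ℝ} (hR : 1 ≤ R) (hRR' : R ≤ R')
    (huR : ∀ a, u a ∈ thicken ({0} : Finset (Site d)) R) (hwR' : ∀ b, w b ∈ thicken ({0} : Finset (Site (d + 1))) R')
    {δ : ℝ} (hδ : ω.cellEnergy (planeResolvedViews p ε U u θ w tz) R' ≤
      infCellEnergyOn (periodicStatesAt (stackPeriods d p) (ω.cellFilling (stackPeriods d p)))
        (planeResolvedViews p ε U u θ w tz) R' + δ) :
    ∑ j : Fin (p + 1), ((ω.layerMarginal (layerCoset d j)).meanEnergy (vectorHoppingModel (U j) u (θ j)) R -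
        (vectorHoppingModel (U j) u (θ j)).tiGroundEnergyDensityAt R ((ω.layerMarginal (layerCoset d j)).density)) ≤
      ((p : ℝ) + 1) * δ + 2 * ∑ jb : Fin (p + 1) × κ, |tz jb.1 jb.2| := by
  have hP : (0 : ℝ) < (p : ℝ) + 1 := by positivity
  have hw0 : ∀ b, w b ≠ 0 := fun b h0 => hw b (by rw [h0]; rfl)
  have hcap := infCellEnergyOn_planeResolved_le_split p hd ε U hu θ hw tz hR hRR' huR hwR'
    (fun j => (ω.layerMarginal (layerCoset d j)).density) fun j => ⟨_, hω.isTranslationInvariant_layerMarginal _, rfl⟩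
  rw [ω.inv_mul_sum_density_layerMarginal p] at hcap
  rw [hω.cellEnergy_planeResolvedViews p ε U hu θ w tz hR hRR' huR] at hδ
  have hI := (abs_le.1 (ω.abs_sum_interlayer_cellEnergy_le p hw0 tz hwR')).1
  set S₁ := ∑ j : Fin (p + 1), ((ω.layerMarginal (layerCoset d j)).meanEnergy (vectorHoppingModel (U j) u (θ j)) R +
    ε j * (ω.layerMarginal (layerCoset d j)).density) with hS₁
  set S₂ := ∑ j : Fin (p + 1),
    ((vectorHoppingModel (U j) u (θ j)).tiGroundEnergyDensityAt R ((ω.layerMarginal (layerCoset d j)).density) +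
      ε j * (ω.layerMarginal (layerCoset d j)).density) with hS₂
  have hdiff : ∑ j : Fin (p + 1), ((ω.layerMarginal (layerCoset d j)).meanEnergy (vectorHoppingModel (U j) u (θ j)) R -
      (vectorHoppingModel (U j) u (θ j)).tiGroundEnergyDensityAt R ((ω.layerMarginal (layerCoset d j)).density)) =
      S₁ - S₂ := by
    rw [hS₁, hS₂, ← Finset.sum_sub_distrib]
    exact Finset.sum_congr rfl fun j _ => by ring
  have h3 : ((p : ℝ) + 1)⁻¹ * S₁ ≤ ((p : ℝ) + 1)⁻¹ * S₂ + δ + 2 / ((p : ℝ) + 1) * ∑ jb : Fin (p + 1) × κ, |tz jb.1 jb.2| := by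
    linarith
  have h4 := mul_le_mul_of_nonneg_left h3 hP.le
  rw [mul_add, mul_add, mul_inv_cancel_left₀ hP.ne', mul_inv_cancel_left₀ hP.ne', ← mul_assoc,
    mul_div_cancel₀ _ hP.ne'] at h4
  rw [hdiff]
  linarith

/-- Each plane excess is non-negative (the marginal is a translation-invariant state of its own density).
[cite: BratteliKishimotoRobinson1978, Thm. 2 (condition 2)] -/
theorem InfVolFermionState.IsPeriodic.tiGroundEnergyDensityAt_le_meanEnergy_layerMarginal
    {ω : InfVolFermionState (d + 1)} (hω : ω.IsPeriodic (stackPeriods d p)) (Ψ : FermionInteraction d) (R : ℝ)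
    (x : Site (d + 1)) :
    Ψ.tiGroundEnergyDensityAt R ((ω.layerMarginal x).density) ≤ (ω.layerMarginal x).meanEnergy Ψ R :=
  Ψ.tiGroundEnergyDensityAt_le_meanEnergy R (hω.isTranslationInvariant_layerMarginal x) rfl

/-- **EVERY PLANE OF A PERIODIC NEAR GROUND STATE IS A NEAR GROUND STATE OF ITS OWN PLANE MODEL AT ITS OWN
FILLING**: `e_{Φ_j}(σ_j) ≤ e_j(ρ(σ_j)) + (p+1)δ + 2Σ|tz|` for each layer class `j` (inner and outer planes
separately, whatever the site energies). [cite: BratteliKishimotoRobinson1978, Thm. 2 (condition 2)] -/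
theorem InfVolFermionState.IsPeriodic.meanEnergy_layerMarginal_le {ω : InfVolFermionState (d + 1)}
    (hω : ω.IsPeriodic (stackPeriods d p)) (hd : 0 < d) (ε U : Fin (p + 1) → ℝ) {u : ι → Site d}
    (hu : ∀ a, u a ≠ 0) (θ : Fin (p + 1) → ι → ℝ) {w : κ → Site (d + 1)} (hw : ∀ b, w b 0 ≠ 0)
    (tz : Fin (p + 1) → κ → ℝ) {R R' : ℝ} (hR : 1 ≤ R) (hRR' : R ≤ R')
    (huR : ∀ a, u a ∈ thicken ({0} : Finset (Site d)) R) (hwR' : ∀ b, w b ∈ thicken ({0} : Finset (Site (d + 1))) R')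
    {δ : ℝ} (hδ : ω.cellEnergy (planeResolvedViews p ε U u θ w tz) R' ≤
      infCellEnergyOn (periodicStatesAt (stackPeriods d p) (ω.cellFilling (stackPeriods d p)))
        (planeResolvedViews p ε U u θ w tz) R' + δ) (j : Fin (p + 1)) :
    (ω.layerMarginal (layerCoset d j)).meanEnergy (vectorHoppingModel (U j) u (θ j)) R ≤
      (vectorHoppingModel (U j) u (θ j)).tiGroundEnergyDensityAt R ((ω.layerMarginal (layerCoset d j)).density) +
        (((p : ℝ) + 1) * δ + 2 * ∑ jb : Fin (p + 1) × κ, |tz jb.1 jb.2|) := by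
  have hsum := hω.sum_layerExcess_le p hd ε U hu θ hw tz hR hRR' huR hwR' hδ
  have hsingle := Finset.single_le_sum (f := fun j : Fin (p + 1) =>
      (ω.layerMarginal (layerCoset d j)).meanEnergy (vectorHoppingModel (U j) u (θ j)) R -
        (vectorHoppingModel (U j) u (θ j)).tiGroundEnergyDensityAt R ((ω.layerMarginal (layerCoset d j)).density))
    (fun i _ => sub_nonneg.2 (hω.tiGroundEnergyDensityAt_le_meanEnergy_layerMarginal p _ R _)) (Finset.mem_univ j)
  linarith

/-- **WORD TRANSFER TO EACH PLANE.** An energy-window word for the plane model `Φ_j` issued on a FILLING RANGE —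
«every translation-invariant `σ` of `ℤ^d` with `nlo ≤ ρ(σ) ≤ nhi` and `e_{Φ_j}(σ) ≤ e_{ρ(σ)}(Φ_j) + ε'` satisfies
`P σ`» (the shape of an energy-constrained SDP word, e.g. a pairing bound) — holds for the marginal of plane `j`
of every periodic near ground state of the crystal whose plane-`j` filling lies in the range, once
`ε' ≥ (p+1)δ + 2Σ|tz|`. [cite: BratteliKishimotoRobinson1978, Thm. 2 (condition 2)] -/
theorem InfVolFermionState.IsPeriodic.of_energyWindow_word_layerMarginal {P : InfVolFermionState d → Prop}
    {ω : InfVolFermionState (d + 1)} (hω : ω.IsPeriodic (stackPeriods d p)) (hd : 0 < d) (ε U : Fin (p + 1) → ℝ)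
    {u : ι → Site d} (hu : ∀ a, u a ≠ 0) (θ : Fin (p + 1) → ι → ℝ) {w : κ → Site (d + 1)} (hw : ∀ b, w b 0 ≠ 0)
    (tz : Fin (p + 1) → κ → ℝ) {R R' : ℝ} (hR : 1 ≤ R) (hRR' : R ≤ R')
    (huR : ∀ a, u a ∈ thicken ({0} : Finset (Site d)) R) (hwR' : ∀ b, w b ∈ thicken ({0} : Finset (Site (d + 1))) R')
    {δ : ℝ} (hδ : ω.cellEnergy (planeResolvedViews p ε U u θ w tz) R' ≤
      infCellEnergyOn (periodicStatesAt (stackPeriods d p) (ω.cellFilling (stackPeriods d p)))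
        (planeResolvedViews p ε U u θ w tz) R' + δ) (j : Fin (p + 1)) {nlo nhi ε' : ℝ}
    (hword : ∀ σ : InfVolFermionState d, σ.IsTranslationInvariant → nlo ≤ σ.density → σ.density ≤ nhi →
      σ.meanEnergy (vectorHoppingModel (U j) u (θ j)) R ≤
        (vectorHoppingModel (U j) u (θ j)).tiGroundEnergyDensityAt R σ.density + ε' → P σ)
    (hlo : nlo ≤ (ω.layerMarginal (layerCoset d j)).density) (hhi : (ω.layerMarginal (layerCoset d j)).density ≤ nhi)
    (hε' : ((p : ℝ) + 1) * δ + 2 * ∑ jb : Fin (p + 1) × κ, |tz jb.1 jb.2| ≤ ε') :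
    P (ω.layerMarginal (layerCoset d j)) :=
  hword _ (hω.isTranslationInvariant_layerMarginal _) hlo hhi
    ((hω.meanEnergy_layerMarginal_le p hd ε U hu θ hw tz hR hRR' huR hwR' hδ j).trans (by linarith))

end NearGroundStates

/-! ### §4. Grand-canonical form: exact decoupling of the plane grand potentials; doping-split brackets -/

section GrandCanonical

variable {ι κ : Type*} [Fintype ι] [Fintype κ] (p : ℕ)

/-- The periodic class is non-empty (the vacuum). [cite: ArakiMoriya2003, §4.1 Def. 4.5] -/
theorem periodicStates_nonempty (q : Fin (d + 1) → ℕ) : (periodicStates q).Nonempty :=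
  ⟨_, (InfVolFermionState.vacuumState_isTranslationInvariant (d := d + 1)).isPeriodic q⟩

/-- **GC CAP, trial form** (site energies `ε_j − μ`, all periodic states): `inf e_μ ≤ (p+1)⁻¹ Σ_j e_{Φ_j + (ε_j−μ)n}(σ_j)`
for every family of translation-invariant `σ_j`. [cite: ArakiMoriya2003, §11.1 Theorem 11.2] -/
theorem infCellEnergyOn_planeResolved_gc_le_trial (hd : 0 < d) (ε U : Fin (p + 1) → ℝ) {u : ι → Site d}
    (hu : ∀ a, u a ≠ 0) (θ : Fin (p + 1) → ι → ℝ) {w : κ → Site (d + 1)} (hw : ∀ b, w b 0 ≠ 0)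
    (tz : Fin (p + 1) → κ → ℝ) {R R' : ℝ} (hR : 1 ≤ R) (hRR' : R ≤ R')
    (huR : ∀ a, u a ∈ thicken ({0} : Finset (Site d)) R) (hwR' : ∀ b, w b ∈ thicken ({0} : Finset (Site (d + 1))) R')
    (μ : ℝ) {σ : Fin (p + 1) → InfVolFermionState d} (hσ : ∀ j, (σ j).IsTranslationInvariant) :
    infCellEnergyOn (periodicStates (stackPeriods d p)) (planeResolvedViews p (fun j => ε j - μ) U u θ w tz) R' ≤
      ((p : ℝ) + 1)⁻¹ * ∑ j, (σ j).meanEnergy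
        (FermionInteraction.pencil (vectorHoppingModel (U j) u (θ j)) (numberInteraction d) (ε j - μ)) R := by
  have he : ∀ j, (σ j).IsEven := fun j => (hσ j).isEven hd
  have hper := InfVolFermionState.isPeriodic_planeStack (p := p) hσ he
  refine (infCellEnergyOn_le_cellEnergy _ R' (show InfVolFermionState.planeStack p σ he ∈
    periodicStates (stackPeriods d p) from hper)).trans (le_of_eq ?_)
  rw [hper.cellEnergy_planeResolvedViews p _ U hu θ w tz hR hRR' huR]
  simp only [InfVolFermionState.layerMarginal_planeStack_layerCoset,
    InfVolFermionState.cellEnergy_planeStack_sublatticeVectorHoppingViews_eq_zero _ _ _ _ (hw _) 1 (hwR' _), mul_zero,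
    Finset.sum_const_zero, add_zero, InfVolFermionState.meanEnergy_pencil, InfVolFermionState.meanEnergy_numberInteraction]

/-- **GC CAP**: `inf_{periodic} e_μ ≤ (p+1)⁻¹ Σ_j g_j(ε_j − μ)` — the mean of the planes' grand potentials at the
shifted chemical potentials `μ − ε_j`. [cite: Rockafellar1970, Thm 16.4] -/
theorem infCellEnergyOn_planeResolved_gc_le (hd : 0 < d) (ε U : Fin (p + 1) → ℝ) {u : ι → Site d}
    (hu : ∀ a, u a ≠ 0) (θ : Fin (p + 1) → ι → ℝ) {w : κ → Site (d + 1)} (hw : ∀ b, w b 0 ≠ 0)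
    (tz : Fin (p + 1) → κ → ℝ) {R R' : ℝ} (hR : 1 ≤ R) (hRR' : R ≤ R')
    (huR : ∀ a, u a ∈ thicken ({0} : Finset (Site d)) R) (hwR' : ∀ b, w b ∈ thicken ({0} : Finset (Site (d + 1))) R')
    (μ : ℝ) :
    infCellEnergyOn (periodicStates (stackPeriods d p)) (planeResolvedViews p (fun j => ε j - μ) U u θ w tz) R' ≤
      ((p : ℝ) + 1)⁻¹ * ∑ j, (FermionInteraction.pencil (vectorHoppingModel (U j) u (θ j)) (numberInteraction d)
        (ε j - μ)).tiGroundEnergyDensity R := by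
  have hP : (0 : ℝ) < (p : ℝ) + 1 := by positivity
  refine le_of_forall_pos_le_add fun δ hδ => ?_
  have hex : ∀ j, ∃ σ : InfVolFermionState d, σ.IsTranslationInvariant ∧
      σ.meanEnergy (FermionInteraction.pencil (vectorHoppingModel (U j) u (θ j)) (numberInteraction d) (ε j - μ)) R <
        (FermionInteraction.pencil (vectorHoppingModel (U j) u (θ j)) (numberInteraction d)
          (ε j - μ)).tiGroundEnergyDensity R + δ := fun j =>
    FermionInteraction.exists_meanEnergy_lt_of_tiGroundEnergyDensity_lt _ R (lt_add_of_pos_right _ hδ)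
  choose σ hσ hlt using hex
  refine (infCellEnergyOn_planeResolved_gc_le_trial p hd ε U hu θ hw tz hR hRR' huR hwR' μ hσ).trans ?_
  calc ((p : ℝ) + 1)⁻¹ * ∑ j, (σ j).meanEnergy
        (FermionInteraction.pencil (vectorHoppingModel (U j) u (θ j)) (numberInteraction d) (ε j - μ)) R
      ≤ ((p : ℝ) + 1)⁻¹ * ∑ j, ((FermionInteraction.pencil (vectorHoppingModel (U j) u (θ j)) (numberInteraction d)
          (ε j - μ)).tiGroundEnergyDensity R + δ) :=
        mul_le_mul_of_nonneg_left (Finset.sum_le_sum fun j _ => (hlt j).le) (inv_pos.2 hP).le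
    _ = _ := by
        rw [Finset.sum_add_distrib, Finset.sum_const, Finset.card_univ, Fintype.card_fin, nsmul_eq_mul, mul_add,
          Nat.cast_add, Nat.cast_one, inv_mul_cancel_left₀ hP.ne']

/-- **GC FLOOR for every periodic state**: `(p+1)⁻¹ Σ_j e_{Φ_j + (ε_j−μ)n}(σ_j) − A ≤ e_μ(ω)`.
[cite: BratteliKishimotoRobinson1978, Thm. 2 (condition 2)] -/
theorem InfVolFermionState.IsPeriodic.gc_sub_allowance_le_cellEnergy_planeResolved {ω : InfVolFermionState (d + 1)}
    (hω : ω.IsPeriodic (stackPeriods d p)) (ε U : Fin (p + 1) → ℝ) {u : ι → Site d} (hu : ∀ a, u a ≠ 0)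
    (θ : Fin (p + 1) → ι → ℝ) {w : κ → Site (d + 1)} (hw : ∀ b, w b ≠ 0) (tz : Fin (p + 1) → κ → ℝ) {R R' : ℝ}
    (hR : 1 ≤ R) (hRR' : R ≤ R') (huR : ∀ a, u a ∈ thicken ({0} : Finset (Site d)) R)
    (hwR' : ∀ b, w b ∈ thicken ({0} : Finset (Site (d + 1))) R') (μ : ℝ) :
    ((p : ℝ) + 1)⁻¹ * ∑ j : Fin (p + 1), (ω.layerMarginal (layerCoset d j)).meanEnergy
        (FermionInteraction.pencil (vectorHoppingModel (U j) u (θ j)) (numberInteraction d) (ε j - μ)) R -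
        2 / ((p : ℝ) + 1) * ∑ jb : Fin (p + 1) × κ, |tz jb.1 jb.2| ≤
      ω.cellEnergy (planeResolvedViews p (fun j => ε j - μ) U u θ w tz) R' := by
  rw [hω.cellEnergy_planeResolvedViews p _ U hu θ w tz hR hRR' huR]
  have hI := (abs_le.1 (ω.abs_sum_interlayer_cellEnergy_le p hw tz hwR')).1
  simp only [InfVolFermionState.meanEnergy_pencil, InfVolFermionState.meanEnergy_numberInteraction]
  have heq : ∑ j : Fin (p + 1), ((ω.layerMarginal (layerCoset d j)).meanEnergy (vectorHoppingModel (U j) u (θ j)) R +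
      (ε j - μ) * (ω.layerMarginal (layerCoset d j)).density) =
      ∑ j : Fin (p + 1), ((ω.layerMarginal (layerCoset d j)).meanEnergy (vectorHoppingModel (U j) u (θ j)) R +
      (ω.layerMarginal (layerCoset d j)).density * (ε j - μ)) :=
    Finset.sum_congr rfl fun j _ => by ring
  rw [heq] at *
  linarith

/-- **GC FLOOR**: `(p+1)⁻¹ Σ_j g_j(ε_j − μ) − A ≤ inf_{periodic} e_μ`. [cite: Rockafellar1970, Thm 16.4] -/
theorem gc_sub_allowance_le_infCellEnergyOn_planeResolved (ε U : Fin (p + 1) → ℝ) {u : ι → Site d}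
    (hu : ∀ a, u a ≠ 0) (θ : Fin (p + 1) → ι → ℝ) {w : κ → Site (d + 1)} (hw : ∀ b, w b ≠ 0)
    (tz : Fin (p + 1) → κ → ℝ) {R R' : ℝ} (hR : 1 ≤ R) (hRR' : R ≤ R')
    (huR : ∀ a, u a ∈ thicken ({0} : Finset (Site d)) R) (hwR' : ∀ b, w b ∈ thicken ({0} : Finset (Site (d + 1))) R')
    (μ : ℝ) :
    ((p : ℝ) + 1)⁻¹ * ∑ j, (FermionInteraction.pencil (vectorHoppingModel (U j) u (θ j)) (numberInteraction d)
        (ε j - μ)).tiGroundEnergyDensity R - 2 / ((p : ℝ) + 1) * ∑ jb : Fin (p + 1) × κ, |tz jb.1 jb.2| ≤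
      infCellEnergyOn (periodicStates (stackPeriods d p)) (planeResolvedViews p (fun j => ε j - μ) U u θ w tz) R' := by
  have hP : (0 : ℝ) < (p : ℝ) + 1 := by positivity
  refine le_infCellEnergyOn _ R' (periodicStates_nonempty _) fun ω hω => ?_
  have hfloor := InfVolFermionState.IsPeriodic.gc_sub_allowance_le_cellEnergy_planeResolved p hω ε U hu θ hw tz hR
    hRR' huR hwR' μ
  have h1 : ∑ j : Fin (p + 1), (FermionInteraction.pencil (vectorHoppingModel (U j) u (θ j)) (numberInteraction d)
      (ε j - μ)).tiGroundEnergyDensity R ≤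
      ∑ j : Fin (p + 1), (ω.layerMarginal (layerCoset d j)).meanEnergy
        (FermionInteraction.pencil (vectorHoppingModel (U j) u (θ j)) (numberInteraction d) (ε j - μ)) R :=
    Finset.sum_le_sum fun j _ => FermionInteraction.tiGroundEnergyDensity_le_meanEnergy _ R
      (InfVolFermionState.IsPeriodic.isTranslationInvariant_layerMarginal hω _)
  have h2 := mul_le_mul_of_nonneg_left h1 (inv_pos.2 hP).le
  linarith

/-- **GC WINDOW — EXACT DECOUPLING OF THE PLANE GRAND POTENTIALS up to the allowance**:
`inf_{periodic} e_μ ∈ [(p+1)⁻¹ Σ_j g_j(ε_j−μ) − A, (p+1)⁻¹ Σ_j g_j(ε_j−μ)]` — the crystal's grand potential per site is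
the mean of the planes' 2D grand potentials at the SHIFTED chemical potentials `μ − ε_j`. [cite: Rockafellar1970, Thm 16.4] -/
theorem infCellEnergyOn_planeResolved_gc_mem_Icc (hd : 0 < d) (ε U : Fin (p + 1) → ℝ) {u : ι → Site d}
    (hu : ∀ a, u a ≠ 0) (θ : Fin (p + 1) → ι → ℝ) {w : κ → Site (d + 1)} (hw : ∀ b, w b 0 ≠ 0)
    (tz : Fin (p + 1) → κ → ℝ) {R R' : ℝ} (hR : 1 ≤ R) (hRR' : R ≤ R')
    (huR : ∀ a, u a ∈ thicken ({0} : Finset (Site d)) R) (hwR' : ∀ b, w b ∈ thicken ({0} : Finset (Site (d + 1))) R')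
    (μ : ℝ) :
    infCellEnergyOn (periodicStates (stackPeriods d p)) (planeResolvedViews p (fun j => ε j - μ) U u θ w tz) R' ∈
      Set.Icc
        (((p : ℝ) + 1)⁻¹ * ∑ j, (FermionInteraction.pencil (vectorHoppingModel (U j) u (θ j)) (numberInteraction d)
          (ε j - μ)).tiGroundEnergyDensity R - 2 / ((p : ℝ) + 1) * ∑ jb : Fin (p + 1) × κ, |tz jb.1 jb.2|)
        (((p : ℝ) + 1)⁻¹ * ∑ j, (FermionInteraction.pencil (vectorHoppingModel (U j) u (θ j)) (numberInteraction d)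
          (ε j - μ)).tiGroundEnergyDensity R) :=
  ⟨gc_sub_allowance_le_infCellEnergyOn_planeResolved p ε U hu θ (fun b h0 => hw b (by rw [h0]; rfl)) tz hR hRR' huR
      hwR' μ,
    infCellEnergyOn_planeResolved_gc_le p hd ε U hu θ hw tz hR hRR' huR hwR' μ⟩

/-- **Chemical potential = uniform shift of the site energies**: `e_μ(ω) = e(ω) − μ ρ̄(ω)` for periodic `ω`.
[cite: Ruelle1969, §3.4] -/
theorem InfVolFermionState.IsPeriodic.cellEnergy_planeResolvedViews_sub_mu {ω : InfVolFermionState (d + 1)}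
    (hω : ω.IsPeriodic (stackPeriods d p)) (ε U : Fin (p + 1) → ℝ) {u : ι → Site d} (hu : ∀ a, u a ≠ 0)
    (θ : Fin (p + 1) → ι → ℝ) (w : κ → Site (d + 1)) (tz : Fin (p + 1) → κ → ℝ) {R R' : ℝ} (hR : 1 ≤ R)
    (hRR' : R ≤ R') (huR : ∀ a, u a ∈ thicken ({0} : Finset (Site d)) R) (μ : ℝ) :
    ω.cellEnergy (planeResolvedViews p (fun j => ε j - μ) U u θ w tz) R' =
      ω.cellEnergy (planeResolvedViews p ε U u θ w tz) R' - μ * ω.cellFilling (stackPeriods d p) := by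
  rw [hω.cellEnergy_planeResolvedViews p _ U hu θ w tz hR hRR' huR, hω.cellEnergy_planeResolvedViews p ε U hu θ w tz hR hRR' huR,
    ← ω.inv_mul_sum_density_layerMarginal p]
  have hs : ∑ j : Fin (p + 1), ((ω.layerMarginal (layerCoset d j)).meanEnergy (vectorHoppingModel (U j) u (θ j)) R +
      (ε j - μ) * (ω.layerMarginal (layerCoset d j)).density) =
      ∑ j : Fin (p + 1), ((ω.layerMarginal (layerCoset d j)).meanEnergy (vectorHoppingModel (U j) u (θ j)) R +
        ε j * (ω.layerMarginal (layerCoset d j)).density) -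
      μ * ∑ j : Fin (p + 1), (ω.layerMarginal (layerCoset d j)).density := by
    rw [Finset.mul_sum, ← Finset.sum_sub_distrib]
    exact Finset.sum_congr rfl fun j _ => by ring
  rw [hs]
  ring

/-- **GC ENERGY BUDGET ⇒ plane GC excesses.** If `e_μ(ω) ≤ (p+1)⁻¹Σ_j g_j(ε_j−μ) + δ'` then
`Σ_j [e_{Φ_j+(ε_j−μ)n}(σ_j) − g_j(ε_j−μ)] ≤ (p+1)δ' + 2Σ|tz|` (each summand `≥ 0`). [cite: BratteliKishimotoRobinson1978, Thm. 2 (condition 2)] -/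
theorem InfVolFermionState.IsPeriodic.sum_layerExcess_gc_le_of_budget {ω : InfVolFermionState (d + 1)}
    (hω : ω.IsPeriodic (stackPeriods d p)) (ε U : Fin (p + 1) → ℝ) {u : ι → Site d}
    (hu : ∀ a, u a ≠ 0) (θ : Fin (p + 1) → ι → ℝ) {w : κ → Site (d + 1)} (hw : ∀ b, w b ≠ 0)
    (tz : Fin (p + 1) → κ → ℝ) {R R' : ℝ} (hR : 1 ≤ R) (hRR' : R ≤ R')
    (huR : ∀ a, u a ∈ thicken ({0} : Finset (Site d)) R) (hwR' : ∀ b, w b ∈ thicken ({0} : Finset (Site (d + 1))) R')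
    (μ : ℝ) {δ' : ℝ} (hbud : ω.cellEnergy (planeResolvedViews p (fun j => ε j - μ) U u θ w tz) R' ≤
      ((p : ℝ) + 1)⁻¹ * ∑ j, (FermionInteraction.pencil (vectorHoppingModel (U j) u (θ j)) (numberInteraction d)
        (ε j - μ)).tiGroundEnergyDensity R + δ') :
    ∑ j : Fin (p + 1), ((ω.layerMarginal (layerCoset d j)).meanEnergy
        (FermionInteraction.pencil (vectorHoppingModel (U j) u (θ j)) (numberInteraction d) (ε j - μ)) R -
        (FermionInteraction.pencil (vectorHoppingModel (U j) u (θ j)) (numberInteraction d)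
          (ε j - μ)).tiGroundEnergyDensity R) ≤
      ((p : ℝ) + 1) * δ' + 2 * ∑ jb : Fin (p + 1) × κ, |tz jb.1 jb.2| := by
  have hP : (0 : ℝ) < (p : ℝ) + 1 := by positivity
  have hfloor := hω.gc_sub_allowance_le_cellEnergy_planeResolved p ε U hu θ hw tz hR hRR' huR hwR' μ
  set S₁ := ∑ j : Fin (p + 1), (ω.layerMarginal (layerCoset d j)).meanEnergy
    (FermionInteraction.pencil (vectorHoppingModel (U j) u (θ j)) (numberInteraction d) (ε j - μ)) R with hS₁
  set S₂ := ∑ j : Fin (p + 1), (FermionInteraction.pencil (vectorHoppingModel (U j) u (θ j)) (numberInteraction d)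
    (ε j - μ)).tiGroundEnergyDensity R with hS₂
  have h3 : ((p : ℝ) + 1)⁻¹ * S₁ ≤ ((p : ℝ) + 1)⁻¹ * S₂ + δ' + 2 / ((p : ℝ) + 1) * ∑ jb : Fin (p + 1) × κ, |tz jb.1 jb.2| := by
    linarith
  have h4 := mul_le_mul_of_nonneg_left h3 hP.le
  rw [mul_add, mul_add, mul_inv_cancel_left₀ hP.ne', mul_inv_cancel_left₀ hP.ne', ← mul_assoc,
    mul_div_cancel₀ _ hP.ne'] at h4
  rw [Finset.sum_sub_distrib]
  linarith

/-- **GC ENERGY BUDGET ⇒ each plane marginal is a near grand-canonical ground state of ITS OWN plane model at ITS OWN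
chemical potential `μ − ε_j`**, excess `≤ (p+1)δ' + 2Σ|tz|`. [cite: BratteliKishimotoRobinson1978, Thm. 2 (condition 2)] -/
theorem InfVolFermionState.IsPeriodic.meanEnergy_layerMarginal_gc_le_of_budget {ω : InfVolFermionState (d + 1)}
    (hω : ω.IsPeriodic (stackPeriods d p)) (ε U : Fin (p + 1) → ℝ) {u : ι → Site d}
    (hu : ∀ a, u a ≠ 0) (θ : Fin (p + 1) → ι → ℝ) {w : κ → Site (d + 1)} (hw : ∀ b, w b ≠ 0)
    (tz : Fin (p + 1) → κ → ℝ) {R R' : ℝ} (hR : 1 ≤ R) (hRR' : R ≤ R')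
    (huR : ∀ a, u a ∈ thicken ({0} : Finset (Site d)) R) (hwR' : ∀ b, w b ∈ thicken ({0} : Finset (Site (d + 1))) R')
    (μ : ℝ) {δ' : ℝ} (hbud : ω.cellEnergy (planeResolvedViews p (fun j => ε j - μ) U u θ w tz) R' ≤
      ((p : ℝ) + 1)⁻¹ * ∑ j, (FermionInteraction.pencil (vectorHoppingModel (U j) u (θ j)) (numberInteraction d)
        (ε j - μ)).tiGroundEnergyDensity R + δ') (j : Fin (p + 1)) :
    (ω.layerMarginal (layerCoset d j)).meanEnergy
        (FermionInteraction.pencil (vectorHoppingModel (U j) u (θ j)) (numberInteraction d) (ε j - μ)) R ≤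
      (FermionInteraction.pencil (vectorHoppingModel (U j) u (θ j)) (numberInteraction d) (ε j - μ)).tiGroundEnergyDensity R +
        (((p : ℝ) + 1) * δ' + 2 * ∑ jb : Fin (p + 1) × κ, |tz jb.1 jb.2|) := by
  have hsum := hω.sum_layerExcess_gc_le_of_budget p ε U hu θ hw tz hR hRR' huR hwR' μ hbud
  have hsingle := Finset.single_le_sum (f := fun j : Fin (p + 1) =>
      (ω.layerMarginal (layerCoset d j)).meanEnergy
        (FermionInteraction.pencil (vectorHoppingModel (U j) u (θ j)) (numberInteraction d) (ε j - μ)) R -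
        (FermionInteraction.pencil (vectorHoppingModel (U j) u (θ j)) (numberInteraction d)
          (ε j - μ)).tiGroundEnergyDensity R)
    (fun i _ => sub_nonneg.2 (FermionInteraction.tiGroundEnergyDensity_le_meanEnergy _ R
      (hω.isTranslationInvariant_layerMarginal _))) (Finset.mem_univ j)
  linarith

/-- **GC ENERGY BUDGET ⇒ LAYER-DENSITY BRACKETS** (Griffiths): with `s_j = ε_j − μ`, `Δ = (p+1)δ' + 2Σ|tz|`,
`(g_j(s_j+h) − g_j(s_j) − Δ)/h ≤ ρ(σ_j) ≤ (g_j(s_j) − g_j(s_j−h) + Δ)/h` for every `h > 0` — raising / lowering the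
site energy of one plane by `h` changes its grand potential by at most `h ρ`. With certified two-sided bounds on
`g_j` at the three points these are NUMBERS. [cite: KomaTasaki1994, §1] -/
theorem InfVolFermionState.IsPeriodic.layerDensity_brackets_of_budget {ω : InfVolFermionState (d + 1)}
    (hω : ω.IsPeriodic (stackPeriods d p)) (ε U : Fin (p + 1) → ℝ) {u : ι → Site d}
    (hu : ∀ a, u a ≠ 0) (θ : Fin (p + 1) → ι → ℝ) {w : κ → Site (d + 1)} (hw : ∀ b, w b ≠ 0)
    (tz : Fin (p + 1) → κ → ℝ) {R R' : ℝ} (hR : 1 ≤ R) (hRR' : R ≤ R')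
    (huR : ∀ a, u a ∈ thicken ({0} : Finset (Site d)) R) (hwR' : ∀ b, w b ∈ thicken ({0} : Finset (Site (d + 1))) R')
    (μ : ℝ) {δ' : ℝ} (hbud : ω.cellEnergy (planeResolvedViews p (fun j => ε j - μ) U u θ w tz) R' ≤
      ((p : ℝ) + 1)⁻¹ * ∑ j, (FermionInteraction.pencil (vectorHoppingModel (U j) u (θ j)) (numberInteraction d)
        (ε j - μ)).tiGroundEnergyDensity R + δ') (j : Fin (p + 1)) {h : ℝ} (hh : 0 < h) :
    ((FermionInteraction.pencil (vectorHoppingModel (U j) u (θ j)) (numberInteraction d) (ε j - μ + h)).tiGroundEnergyDensity R -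
        (FermionInteraction.pencil (vectorHoppingModel (U j) u (θ j)) (numberInteraction d) (ε j - μ)).tiGroundEnergyDensity R -
        (((p : ℝ) + 1) * δ' + 2 * ∑ jb : Fin (p + 1) × κ, |tz jb.1 jb.2|)) / h ≤
      (ω.layerMarginal (layerCoset d j)).density ∧
    (ω.layerMarginal (layerCoset d j)).density ≤
      ((FermionInteraction.pencil (vectorHoppingModel (U j) u (θ j)) (numberInteraction d) (ε j - μ)).tiGroundEnergyDensity R -
        (FermionInteraction.pencil (vectorHoppingModel (U j) u (θ j)) (numberInteraction d) (ε j - μ - h)).tiGroundEnergyDensity R +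
        (((p : ℝ) + 1) * δ' + 2 * ∑ jb : Fin (p + 1) × κ, |tz jb.1 jb.2|)) / h := by
  have hTI := hω.isTranslationInvariant_layerMarginal (layerCoset d j)
  have hnear := hω.meanEnergy_layerMarginal_gc_le_of_budget p ε U hu θ hw tz hR hRR' huR hwR' μ hbud j
  have hup := FermionInteraction.tiGroundEnergyDensity_le_meanEnergy
    (FermionInteraction.pencil (vectorHoppingModel (U j) u (θ j)) (numberInteraction d) (ε j - μ + h)) R hTI
  have hdown := FermionInteraction.tiGroundEnergyDensity_le_meanEnergy
    (FermionInteraction.pencil (vectorHoppingModel (U j) u (θ j)) (numberInteraction d) (ε j - μ - h)) R hTI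
  rw [InfVolFermionState.meanEnergy_pencil_eq_add_sub_mul _ _ _ (ε j - μ),
    InfVolFermionState.meanEnergy_numberInteraction] at hup hdown
  constructor
  · rw [div_le_iff₀ hh]
    nlinarith
  · rw [le_div_iff₀ hh]
    nlinarith

/-- A grand-canonical near minimiser (within `δ` of `inf_{periodic} e_μ`) has GC budget `δ`. [cite: Rockafellar1970, Thm 16.4] -/
theorem InfVolFermionState.IsPeriodic.gc_budget_of_gc_nearMin {ω : InfVolFermionState (d + 1)}
    (hω : ω.IsPeriodic (stackPeriods d p)) (hd : 0 < d) (ε U : Fin (p + 1) → ℝ) {u : ι → Site d}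
    (hu : ∀ a, u a ≠ 0) (θ : Fin (p + 1) → ι → ℝ) {w : κ → Site (d + 1)} (hw : ∀ b, w b 0 ≠ 0)
    (tz : Fin (p + 1) → κ → ℝ) {R R' : ℝ} (hR : 1 ≤ R) (hRR' : R ≤ R')
    (huR : ∀ a, u a ∈ thicken ({0} : Finset (Site d)) R) (hwR' : ∀ b, w b ∈ thicken ({0} : Finset (Site (d + 1))) R')
    (μ : ℝ) {δ : ℝ} (hδ : ω.cellEnergy (planeResolvedViews p (fun j => ε j - μ) U u θ w tz) R' ≤
      infCellEnergyOn (periodicStates (stackPeriods d p)) (planeResolvedViews p (fun j => ε j - μ) U u θ w tz) R' + δ) :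
    ω.cellEnergy (planeResolvedViews p (fun j => ε j - μ) U u θ w tz) R' ≤
      ((p : ℝ) + 1)⁻¹ * ∑ j, (FermionInteraction.pencil (vectorHoppingModel (U j) u (θ j)) (numberInteraction d)
        (ε j - μ)).tiGroundEnergyDensity R + δ := by
  have _ := hω
  linarith [infCellEnergyOn_planeResolved_gc_le p hd ε U hu θ hw tz hR hRR' huR hwR' μ]

/-- **A CANONICAL near minimiser has a GC budget at every trial `μ`**: within `δ` of the infimum at its own cell
filling `ρ̄` ⇒ `e_μ(ω) ≤ (p+1)⁻¹Σ g_j + δ + B(μ)`, `B(μ) = inf_{filling ρ̄} e − μρ̄ − (p+1)⁻¹Σ_j g_j(ε_j−μ)` (how far `μ` is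
from a chemical potential of the crystal at `ρ̄`; `≥ −A` by the next theorem; computable from above by any split cap).
[cite: Ruelle1969, §3.4] -/
theorem InfVolFermionState.IsPeriodic.gc_budget_of_nearMin {ω : InfVolFermionState (d + 1)}
    (hω : ω.IsPeriodic (stackPeriods d p)) (ε U : Fin (p + 1) → ℝ) {u : ι → Site d}
    (hu : ∀ a, u a ≠ 0) (θ : Fin (p + 1) → ι → ℝ) (w : κ → Site (d + 1))
    (tz : Fin (p + 1) → κ → ℝ) {R R' : ℝ} (hR : 1 ≤ R) (hRR' : R ≤ R')
    (huR : ∀ a, u a ∈ thicken ({0} : Finset (Site d)) R)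
    (μ : ℝ) {δ : ℝ} (hδ : ω.cellEnergy (planeResolvedViews p ε U u θ w tz) R' ≤
      infCellEnergyOn (periodicStatesAt (stackPeriods d p) (ω.cellFilling (stackPeriods d p)))
        (planeResolvedViews p ε U u θ w tz) R' + δ) :
    ω.cellEnergy (planeResolvedViews p (fun j => ε j - μ) U u θ w tz) R' ≤
      ((p : ℝ) + 1)⁻¹ * ∑ j, (FermionInteraction.pencil (vectorHoppingModel (U j) u (θ j)) (numberInteraction d)
        (ε j - μ)).tiGroundEnergyDensity R +
      (δ + (infCellEnergyOn (periodicStatesAt (stackPeriods d p) (ω.cellFilling (stackPeriods d p)))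
        (planeResolvedViews p ε U u θ w tz) R' - μ * ω.cellFilling (stackPeriods d p) -
        ((p : ℝ) + 1)⁻¹ * ∑ j, (FermionInteraction.pencil (vectorHoppingModel (U j) u (θ j)) (numberInteraction d)
          (ε j - μ)).tiGroundEnergyDensity R)) := by
  rw [hω.cellEnergy_planeResolvedViews_sub_mu p ε U hu θ w tz hR hRR' huR μ]
  linarith

/-- **`B(μ) ≥ −A`**: `(p+1)⁻¹ Σ_j g_j(ε_j−μ) − A ≤ inf_{filling ρ̄} e − μ ρ̄` for every `μ` and `ρ̄`. [cite: Rockafellar1970, Thm 16.4] -/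
theorem gc_sub_allowance_le_infCellEnergyOn_planeResolved_sub_mu (ε U : Fin (p + 1) → ℝ) {u : ι → Site d}
    (hu : ∀ a, u a ≠ 0) (θ : Fin (p + 1) → ι → ℝ) {w : κ → Site (d + 1)} (hw : ∀ b, w b ≠ 0)
    (tz : Fin (p + 1) → κ → ℝ) {R R' : ℝ} (hR : 1 ≤ R) (hRR' : R ≤ R')
    (huR : ∀ a, u a ∈ thicken ({0} : Finset (Site d)) R) (hwR' : ∀ b, w b ∈ thicken ({0} : Finset (Site (d + 1))) R')
    (μ : ℝ) {ρbar : ℝ} (hS : (periodicStatesAt (stackPeriods d p) ρbar).Nonempty) :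
    ((p : ℝ) + 1)⁻¹ * ∑ j, (FermionInteraction.pencil (vectorHoppingModel (U j) u (θ j)) (numberInteraction d)
        (ε j - μ)).tiGroundEnergyDensity R - 2 / ((p : ℝ) + 1) * ∑ jb : Fin (p + 1) × κ, |tz jb.1 jb.2| ≤
      infCellEnergyOn (periodicStatesAt (stackPeriods d p) ρbar) (planeResolvedViews p ε U u θ w tz) R' - μ * ρbar := by
  rw [le_sub_iff_add_le]
  refine le_infCellEnergyOn _ R' hS fun ω hω => ?_
  have hfloor := hω.1.gc_sub_allowance_le_cellEnergy_planeResolved p ε U hu θ hw tz hR hRR' huR hwR' μ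
  rw [hω.1.cellEnergy_planeResolvedViews_sub_mu p ε U hu θ w tz hR hRR' huR μ, hω.2] at hfloor
  have h1 : ∑ j : Fin (p + 1), (FermionInteraction.pencil (vectorHoppingModel (U j) u (θ j)) (numberInteraction d)
      (ε j - μ)).tiGroundEnergyDensity R ≤
      ∑ j : Fin (p + 1), (ω.layerMarginal (layerCoset d j)).meanEnergy
        (FermionInteraction.pencil (vectorHoppingModel (U j) u (θ j)) (numberInteraction d) (ε j - μ)) R :=
    Finset.sum_le_sum fun j _ => FermionInteraction.tiGroundEnergyDensity_le_meanEnergy _ R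
      (hω.1.isTranslationInvariant_layerMarginal _)
  have hP : (0 : ℝ) < (p : ℝ) + 1 := by positivity
  have h2 := mul_le_mul_of_nonneg_left h1 (inv_pos.2 hP).le
  linarith

/-- **DOPING-SPLIT BRACKETS, grand-canonical**: for a periodic `ω` within `δ` of `inf_{periodic} e_μ`, every layer
density `ρ(σ_j)` is bracketed by difference quotients of ITS OWN plane's grand potential `g_j` around `s_j = ε_j − μ`
(`Δ = (p+1)δ + 2Σ|tz|`). The inner/outer-plane doping of a multilayer crystal from 2D words. [cite: KomaTasaki1994, §1] -/
theorem InfVolFermionState.IsPeriodic.layerDensity_brackets {ω : InfVolFermionState (d + 1)}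
    (hω : ω.IsPeriodic (stackPeriods d p)) (hd : 0 < d) (ε U : Fin (p + 1) → ℝ) {u : ι → Site d}
    (hu : ∀ a, u a ≠ 0) (θ : Fin (p + 1) → ι → ℝ) {w : κ → Site (d + 1)} (hw : ∀ b, w b 0 ≠ 0)
    (tz : Fin (p + 1) → κ → ℝ) {R R' : ℝ} (hR : 1 ≤ R) (hRR' : R ≤ R')
    (huR : ∀ a, u a ∈ thicken ({0} : Finset (Site d)) R) (hwR' : ∀ b, w b ∈ thicken ({0} : Finset (Site (d + 1))) R')
    (μ : ℝ) {δ : ℝ} (hδ : ω.cellEnergy (planeResolvedViews p (fun j => ε j - μ) U u θ w tz) R' ≤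
      infCellEnergyOn (periodicStates (stackPeriods d p)) (planeResolvedViews p (fun j => ε j - μ) U u θ w tz) R' + δ)
    (j : Fin (p + 1)) {h : ℝ} (hh : 0 < h) :
    ((FermionInteraction.pencil (vectorHoppingModel (U j) u (θ j)) (numberInteraction d) (ε j - μ + h)).tiGroundEnergyDensity R -
        (FermionInteraction.pencil (vectorHoppingModel (U j) u (θ j)) (numberInteraction d) (ε j - μ)).tiGroundEnergyDensity R -
        (((p : ℝ) + 1) * δ + 2 * ∑ jb : Fin (p + 1) × κ, |tz jb.1 jb.2|)) / h ≤
      (ω.layerMarginal (layerCoset d j)).density ∧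
    (ω.layerMarginal (layerCoset d j)).density ≤
      ((FermionInteraction.pencil (vectorHoppingModel (U j) u (θ j)) (numberInteraction d) (ε j - μ)).tiGroundEnergyDensity R -
        (FermionInteraction.pencil (vectorHoppingModel (U j) u (θ j)) (numberInteraction d) (ε j - μ - h)).tiGroundEnergyDensity R +
        (((p : ℝ) + 1) * δ + 2 * ∑ jb : Fin (p + 1) × κ, |tz jb.1 jb.2|)) / h :=
  hω.layerDensity_brackets_of_budget p ε U hu θ (fun b h0 => hw b (by rw [h0]; rfl)) tz hR hRR' huR hwR' μ
    (hω.gc_budget_of_gc_nearMin p hd ε U hu θ hw tz hR hRR' huR hwR' μ hδ) j hh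

/-- **DOPING-SPLIT BRACKETS, canonical**: for a periodic `ω` within `δ` of the infimum at ITS OWN CELL FILLING and any
trial `μ` with `B(μ) ≤ B`, the same brackets with `Δ = (p+1)(δ + B) + 2Σ|tz|`. [cite: KomaTasaki1994, §1] -/
theorem InfVolFermionState.IsPeriodic.layerDensity_brackets_canonical {ω : InfVolFermionState (d + 1)}
    (hω : ω.IsPeriodic (stackPeriods d p)) (ε U : Fin (p + 1) → ℝ) {u : ι → Site d}
    (hu : ∀ a, u a ≠ 0) (θ : Fin (p + 1) → ι → ℝ) {w : κ → Site (d + 1)} (hw : ∀ b, w b ≠ 0)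
    (tz : Fin (p + 1) → κ → ℝ) {R R' : ℝ} (hR : 1 ≤ R) (hRR' : R ≤ R')
    (huR : ∀ a, u a ∈ thicken ({0} : Finset (Site d)) R) (hwR' : ∀ b, w b ∈ thicken ({0} : Finset (Site (d + 1))) R')
    (μ : ℝ) {δ B : ℝ} (hδ : ω.cellEnergy (planeResolvedViews p ε U u θ w tz) R' ≤
      infCellEnergyOn (periodicStatesAt (stackPeriods d p) (ω.cellFilling (stackPeriods d p)))
        (planeResolvedViews p ε U u θ w tz) R' + δ)
    (hB : infCellEnergyOn (periodicStatesAt (stackPeriods d p) (ω.cellFilling (stackPeriods d p)))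
        (planeResolvedViews p ε U u θ w tz) R' - μ * ω.cellFilling (stackPeriods d p) -
        ((p : ℝ) + 1)⁻¹ * ∑ j, (FermionInteraction.pencil (vectorHoppingModel (U j) u (θ j)) (numberInteraction d)
          (ε j - μ)).tiGroundEnergyDensity R ≤ B)
    (j : Fin (p + 1)) {h : ℝ} (hh : 0 < h) :
    ((FermionInteraction.pencil (vectorHoppingModel (U j) u (θ j)) (numberInteraction d) (ε j - μ + h)).tiGroundEnergyDensity R -
        (FermionInteraction.pencil (vectorHoppingModel (U j) u (θ j)) (numberInteraction d) (ε j - μ)).tiGroundEnergyDensity R -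
        (((p : ℝ) + 1) * (δ + B) + 2 * ∑ jb : Fin (p + 1) × κ, |tz jb.1 jb.2|)) / h ≤
      (ω.layerMarginal (layerCoset d j)).density ∧
    (ω.layerMarginal (layerCoset d j)).density ≤
      ((FermionInteraction.pencil (vectorHoppingModel (U j) u (θ j)) (numberInteraction d) (ε j - μ)).tiGroundEnergyDensity R -
        (FermionInteraction.pencil (vectorHoppingModel (U j) u (θ j)) (numberInteraction d) (ε j - μ - h)).tiGroundEnergyDensity R +
        (((p : ℝ) + 1) * (δ + B) + 2 * ∑ jb : Fin (p + 1) × κ, |tz jb.1 jb.2|)) / h :=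
  hω.layerDensity_brackets_of_budget p ε U hu θ hw tz hR hRR' huR hwR' μ
    ((hω.gc_budget_of_nearMin p ε U hu θ w tz hR hRR' huR μ hδ).trans (by linarith)) j hh

end GrandCanonical

/-! ### §5 (append). At a supporting chemical potential the canonical slack vanishes -/

section Supporting

variable {ι κ : Type*} [Fintype ι] [Fintype κ] (p : ℕ)

/-- **A supporting chemical potential of the crystal's energy–filling curve has `B(μ) ≤ 0`.** If `μ` supports
`ρ̄' ↦ inf_{filling ρ̄'} e` at `ρ̄` (`inf_{ρ̄} e + μ(ρ̄' − ρ̄) ≤ inf_{ρ̄'} e` for every non-empty filling class), then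
`inf_{filling ρ̄} e − μρ̄ − (p+1)⁻¹ Σ_j g_j(ε_j − μ) ≤ 0` — so the canonical doping-split brackets
(`IsPeriodic.layerDensity_brackets_canonical`) hold with `B = 0` at such `μ` (equivalence of ensembles for the crystal:
the canonical infimum at `ρ̄` minus `μρ̄` is below the grand-canonical infimum, which is below the decoupled mean).
[cite: Ruelle1969, §3.4] -/
theorem infCellEnergyOn_sub_mu_sub_gc_le_zero_of_supporting (hd : 0 < d) (ε U : Fin (p + 1) → ℝ) {u : ι → Site d}
    (hu : ∀ a, u a ≠ 0) (θ : Fin (p + 1) → ι → ℝ) {w : κ → Site (d + 1)} (hw : ∀ b, w b 0 ≠ 0)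
    (tz : Fin (p + 1) → κ → ℝ) {R R' : ℝ} (hR : 1 ≤ R) (hRR' : R ≤ R')
    (huR : ∀ a, u a ∈ thicken ({0} : Finset (Site d)) R) (hwR' : ∀ b, w b ∈ thicken ({0} : Finset (Site (d + 1))) R')
    {ρbar : ℝ} (μ : ℝ)
    (hsupp : ∀ ρ' : ℝ, (periodicStatesAt (stackPeriods d p) ρ').Nonempty →
      infCellEnergyOn (periodicStatesAt (stackPeriods d p) ρbar) (planeResolvedViews p ε U u θ w tz) R' + μ * (ρ' - ρbar) ≤
        infCellEnergyOn (periodicStatesAt (stackPeriods d p) ρ') (planeResolvedViews p ε U u θ w tz) R') :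
    infCellEnergyOn (periodicStatesAt (stackPeriods d p) ρbar) (planeResolvedViews p ε U u θ w tz) R' - μ * ρbar -
        ((p : ℝ) + 1)⁻¹ * ∑ j, (FermionInteraction.pencil (vectorHoppingModel (U j) u (θ j)) (numberInteraction d)
          (ε j - μ)).tiGroundEnergyDensity R ≤ 0 := by
  -- the canonical infimum at `ρ̄` minus `μρ̄` is below `e_μ(ω)` for every periodic `ω` (supporting property at `ω`'s filling)
  have hle : infCellEnergyOn (periodicStatesAt (stackPeriods d p) ρbar) (planeResolvedViews p ε U u θ w tz) R' - μ * ρbar ≤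
      infCellEnergyOn (periodicStates (stackPeriods d p)) (planeResolvedViews p (fun j => ε j - μ) U u θ w tz) R' := by
    refine le_infCellEnergyOn _ R' (periodicStates_nonempty _) fun ω hω => ?_
    have hωper : ω.IsPeriodic (stackPeriods d p) := hω
    have hmem : ω ∈ periodicStatesAt (stackPeriods d p) (ω.cellFilling (stackPeriods d p)) := ⟨hωper, rfl⟩
    have h1 := hsupp (ω.cellFilling (stackPeriods d p)) ⟨ω, hmem⟩
    have h2 := infCellEnergyOn_le_cellEnergy (planeResolvedViews p ε U u θ w tz) R' hmem
    rw [hωper.cellEnergy_planeResolvedViews_sub_mu p ε U hu θ w tz hR hRR' huR μ]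
    linarith
  have hcap := infCellEnergyOn_planeResolved_gc_le p hd ε U hu θ hw tz hR hRR' huR hwR' μ
  linarith

/-- **DOPING-SPLIT BRACKETS AT A SUPPORTING CHEMICAL POTENTIAL** (canonical, no extra slack): for a periodic `ω`
within `δ` of the infimum at its own cell filling `ρ̄` and a supporting `μ` of the energy–filling curve at `ρ̄`, the
layer densities obey the grand-canonical brackets with `Δ = (p+1)δ + 2Σ|tz|`. [cite: KomaTasaki1994, §1] -/
theorem InfVolFermionState.IsPeriodic.layerDensity_brackets_of_supporting {ω : InfVolFermionState (d + 1)}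
    (hω : ω.IsPeriodic (stackPeriods d p)) (hd : 0 < d) (ε U : Fin (p + 1) → ℝ) {u : ι → Site d}
    (hu : ∀ a, u a ≠ 0) (θ : Fin (p + 1) → ι → ℝ) {w : κ → Site (d + 1)} (hw : ∀ b, w b 0 ≠ 0)
    (tz : Fin (p + 1) → κ → ℝ) {R R' : ℝ} (hR : 1 ≤ R) (hRR' : R ≤ R')
    (huR : ∀ a, u a ∈ thicken ({0} : Finset (Site d)) R) (hwR' : ∀ b, w b ∈ thicken ({0} : Finset (Site (d + 1))) R')
    (μ : ℝ) {δ : ℝ} (hδ : ω.cellEnergy (planeResolvedViews p ε U u θ w tz) R' ≤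
      infCellEnergyOn (periodicStatesAt (stackPeriods d p) (ω.cellFilling (stackPeriods d p)))
        (planeResolvedViews p ε U u θ w tz) R' + δ)
    (hsupp : ∀ ρ' : ℝ, (periodicStatesAt (stackPeriods d p) ρ').Nonempty →
      infCellEnergyOn (periodicStatesAt (stackPeriods d p) (ω.cellFilling (stackPeriods d p)))
          (planeResolvedViews p ε U u θ w tz) R' + μ * (ρ' - ω.cellFilling (stackPeriods d p)) ≤
        infCellEnergyOn (periodicStatesAt (stackPeriods d p) ρ') (planeResolvedViews p ε U u θ w tz) R')
    (j : Fin (p + 1)) {h : ℝ} (hh : 0 < h) :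
    ((FermionInteraction.pencil (vectorHoppingModel (U j) u (θ j)) (numberInteraction d) (ε j - μ + h)).tiGroundEnergyDensity R -
        (FermionInteraction.pencil (vectorHoppingModel (U j) u (θ j)) (numberInteraction d) (ε j - μ)).tiGroundEnergyDensity R -
        (((p : ℝ) + 1) * δ + 2 * ∑ jb : Fin (p + 1) × κ, |tz jb.1 jb.2|)) / h ≤
      (ω.layerMarginal (layerCoset d j)).density ∧
    (ω.layerMarginal (layerCoset d j)).density ≤
      ((FermionInteraction.pencil (vectorHoppingModel (U j) u (θ j)) (numberInteraction d) (ε j - μ)).tiGroundEnergyDensity R -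
        (FermionInteraction.pencil (vectorHoppingModel (U j) u (θ j)) (numberInteraction d) (ε j - μ - h)).tiGroundEnergyDensity R +
        (((p : ℝ) + 1) * δ + 2 * ∑ jb : Fin (p + 1) × κ, |tz jb.1 jb.2|)) / h := by
  have hB := infCellEnergyOn_sub_mu_sub_gc_le_zero_of_supporting p hd ε U hu θ hw tz hR hRR' huR hwR' μ hsupp
  have h := hω.layerDensity_brackets_canonical p ε U hu θ (fun b h0 => hw b (by rw [h0]; rfl)) tz hR hRR' huR hwR' μ hδ
    hB j hh
  simpa only [add_zero] using h

end Supporting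

end Literature.MathematicalPhysics.QuantumLattice
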